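import Mathlib.Analysis.Calculus.UniformLimitsDeriv
import Literature.Analysis.Complex.OsgoodProofs
import HarnessLib

/-!
# Locally uniform limits of holomorphic functions of several complex variables are holomorphic

Weierstrass' convergence theorem in several variables (Hörmander, *An Introduction to Complex
Analysis in Several Variables* (1973), Cor. 2.2.5 of Thm. 2.2.3/2.2.4 in one variable applied
slice-wise; Gunning–Rossi Ch. I §A; the statement used verbatim by Kotecký–Preiss (1986, p. 493:
"the estimate (4) and Vitali theorem imply the analyticity of the free energy") and by Ueltschi
(1999, proof of Thm. 2.1 (i)) to pass analyticity to thermodynamic limits): if `f_i : E → F` are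
complex-(Fréchet-)differentiable on an open set `U` of a finite-dimensional complex normed space
`E` (`F` complete) and `f_i → g` locally uniformly on `U` along a non-trivial filter, then `g` is
complex-differentiable on `U`, `fderiv f_i → fderiv g` locally uniformly, and hence
(Osgood, `Literature.Analysis.Complex.SCV.analyticOnNhd_of_differentiableOn`) `g` is analytic on `U`.

Mathlib has the one-variable theorem (`TendstoLocallyUniformlyOn.differentiableOn`,
`Mathlib/Analysis/Complex/LocallyUniformLimit.lean`, via a Cauchy-integral derivative `cderiv`) and
the abstract swap of limit and derivative under locally uniform convergence OF THE DERIVATIVES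
(`hasFDerivAt_of_tendsto_locally_uniformly_on'`); the several-variable statement is obtained here by
feeding the latter with the Cauchy estimate of `SeveralVariables.lean`
(`Literature.Analysis.Complex.SCV.norm_fderiv_apply_le`): on a ball `B(x₀, r)` with
`B̄(x₀, 2r) ⊆ U`, `‖D f_i(x) - D f_j(x)‖ ≤ r⁻¹ sup_{B̄(x₀,2r)} ‖f_i - f_j‖`, so the derivatives are
locally uniformly Cauchy, converge (completeness of `E →L[ℂ] F`), and the limit is `D g`.
All statements are theorems; no definitions. Everything is PROVED.

## Main results (namespace `Literature.Analysis.Complex.SCV`)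

* `norm_fderiv_le_of_closedBall_two_mul`: operator-norm Cauchy estimate on `B̄(x₀, r)` from a sup
  bound on `B̄(x₀, 2r)`.
* `uniformCauchySeqOn_fderiv`: the derivatives of a locally uniformly convergent family of
  holomorphic maps are uniformly Cauchy on small balls.
* `exists_tendstoLocallyUniformlyOn_fderiv`, `differentiableOn_of_tendstoLocallyUniformlyOn`,
  `hasFDerivAt_of_tendstoLocallyUniformlyOn_of_differentiableOn`: **Weierstrass' theorem** — the
  limit is holomorphic and the derivatives converge locally uniformly to its derivative.
* `analyticOnNhd_of_tendstoLocallyUniformlyOn`: the limit is analytic (with Osgood's lemma).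
* `analyticOnNhd_tsum_of_summable_norm`: normally convergent series of holomorphic maps are analytic
  (Weierstrass M-test form, the shape in which cluster expansions are summed).

## References

* L. Hörmander, *An Introduction to Complex Analysis in Several Variables* (1973), §2.2
  (Thm. 2.2.1, Cor. 2.2.5). [HormanderSCV1973]
* R. Kotecký, D. Preiss, Comm. Math. Phys. 103 (1986) 491–498, p. 493. [KoteckyPreiss1986]
-/

noncomputable section

open Metric Set Filter Topology

namespace Literature.Analysis.Complex.SCV

variable {E : Type*} [NormedAddCommGroup E] [NormedSpace ℂ E]
  {F : Type*} [NormedAddCommGroup F] [NormedSpace ℂ F] [CompleteSpace F]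

/-! ### Operator-norm Cauchy estimate on concentric balls -/

omit [CompleteSpace F] in
/-- **Cauchy estimate for the Fréchet derivative on concentric balls**: if `f` is
complex-differentiable on an open `U ⊇ B̄(x₀, 2r)` and `‖f‖ ≤ M` on `B̄(x₀, 2r)`, then
`‖D f(x)‖ ≤ M / r` for every `x ∈ B̄(x₀, r)` (apply the directional Cauchy estimate on the complex
disc `{x + t v : |t| ≤ r}`, `‖v‖ ≤ 1`, which stays in `B̄(x₀, 2r)`). [cite: HormanderSCV1973, Thm 2.2.7 (Cauchy's inequalities)] -/
theorem norm_fderiv_le_of_closedBall_two_mul {f : E → F} {U : Set E} (hf : DifferentiableOn ℂ f U)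
    (hU : IsOpen U) {x₀ : E} {r M : ℝ} (hr : 0 < r) (hsub : closedBall x₀ (2 * r) ⊆ U)
    (hM : 0 ≤ M) (hfM : ∀ y ∈ closedBall x₀ (2 * r), ‖f y‖ ≤ M) {x : E}
    (hx : x ∈ closedBall x₀ r) : ‖fderiv ℂ f x‖ ≤ M / r := by
  refine opNorm_le_of_unit_ball _ (div_nonneg hM hr.le) fun v hv => ?_
  have hmem : ∀ t ∈ closedBall (0 : ℂ) r, x + t • v ∈ closedBall x₀ (2 * r) := by
    intro t ht
    rw [mem_closedBall, dist_eq_norm] at hx ⊢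
    rw [mem_closedBall, dist_zero_right] at ht
    calc ‖x + t • v - x₀‖ = ‖(x - x₀) + t • v‖ := by congr 1; abel
      _ ≤ ‖x - x₀‖ + ‖t • v‖ := norm_add_le _ _
      _ ≤ r + r * 1 := by
          rw [norm_smul]
          exact add_le_add hx (mul_le_mul ht hv (norm_nonneg _) hr.le)
      _ = 2 * r := by ring
  exact norm_fderiv_apply_le hf hU hr (fun t ht => hsub (hmem t ht))
    fun t ht => hfM _ (hmem t (sphere_subset_closedBall ht))

/-! ### Derivatives of a locally uniformly convergent family are locally uniformly Cauchy -/

variable {ι : Type*} {l : Filter ι}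

omit [CompleteSpace F] in
/-- On a ball `B(x₀, r)` with `B̄(x₀, 2r) ⊆ U` on whose closure the family converges uniformly, the
Fréchet derivatives of complex-differentiable maps `f_i` form a uniformly Cauchy family: by the
Cauchy estimate applied to `f_i - f_j`, `‖D f_i(x) - D f_j(x)‖ ≤ r⁻¹ sup_{B̄(x₀,2r)} ‖f_i - f_j‖`.
[cite: HormanderSCV1973, §2.2 (Cor. 2.2.5, several-variable Weierstrass theorem)] -/
theorem uniformCauchySeqOn_fderiv {f : ι → E → F} {g : E → F} {U : Set E} (hU : IsOpen U)
    (hf : ∀ i, DifferentiableOn ℂ (f i) U) {x₀ : E} {r : ℝ} (hr : 0 < r)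
    (hsub : closedBall x₀ (2 * r) ⊆ U)
    (hunif : TendstoUniformlyOn f g l (closedBall x₀ (2 * r))) :
    UniformCauchySeqOn (fun i => fderiv ℂ (f i)) l (closedBall x₀ r) := by
  have hC := hunif.uniformCauchySeqOn
  intro u hu
  obtain ⟨ε, hε, hεu⟩ := Metric.mem_uniformity_dist.1 hu
  have hεr : 0 < ε * r / 2 := by positivity
  filter_upwards [hC _ (Metric.dist_mem_uniformity hεr)] with p hp x hx
  refine hεu ?_
  rw [dist_eq_norm]
  -- Cauchy estimate for the holomorphic difference `f p.1 - f p.2`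
  have hdiff : DifferentiableOn ℂ (fun y => f p.1 y - f p.2 y) U := (hf p.1).sub (hf p.2)
  have hbound : ∀ y ∈ closedBall x₀ (2 * r), ‖f p.1 y - f p.2 y‖ ≤ ε * r / 2 := by
    intro y hy
    have := hp y hy
    rw [dist_eq_norm] at this
    exact this.le
  have key := norm_fderiv_le_of_closedBall_two_mul hdiff hU hr hsub hεr.le hbound hx
  have hxU : x ∈ U := hsub (closedBall_subset_closedBall (by linarith) hx)
  have hfd : fderiv ℂ (fun y => f p.1 y - f p.2 y) x = fderiv ℂ (f p.1) x - fderiv ℂ (f p.2) x :=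
    fderiv_sub ((hf p.1).differentiableAt (hU.mem_nhds hxU))
      ((hf p.2).differentiableAt (hU.mem_nhds hxU))
  rw [hfd] at key
  calc ‖fderiv ℂ (f p.1) x - fderiv ℂ (f p.2) x‖ ≤ ε * r / 2 / r := key
    _ = ε / 2 := by field_simp
    _ < ε := by linarith

/-! ### Weierstrass' theorem in several variables -/

/-- **The derivatives of a locally uniformly convergent family of holomorphic maps converge locally
uniformly** (to SOME limit `g'`; it is identified with `D g` below): `E` finite-dimensional, `F`
complete. Uniformly Cauchy on small balls by `uniformCauchySeqOn_fderiv`, pointwise convergent by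
completeness of `E →L[ℂ] F`. [cite: HormanderSCV1973, §2.2 (Cor. 2.2.5, several-variable Weierstrass theorem)] -/
theorem exists_tendstoLocallyUniformlyOn_fderiv [FiniteDimensional ℂ E] [l.NeBot] {f : ι → E → F}
    {g : E → F} {U : Set E} (hU : IsOpen U) (hf : ∀ i, DifferentiableOn ℂ (f i) U)
    (hlim : TendstoLocallyUniformlyOn f g l U) :
    ∃ g' : E → E →L[ℂ] F, TendstoLocallyUniformlyOn (fun i => fderiv ℂ (f i)) g' l U := by
  haveI : ProperSpace E := FiniteDimensional.proper_rclike ℂ E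
  -- uniform convergence on every compact subset of `U`
  have hK : ∀ K ⊆ U, IsCompact K → TendstoUniformlyOn f g l K :=
    (tendstoLocallyUniformlyOn_iff_forall_isCompact hU).1 hlim
  -- small balls: `B̄(x, 2 r x) ⊆ U`
  have hball : ∀ x ∈ U, ∃ r > 0, closedBall x (2 * r) ⊆ U := by
    intro x hx
    obtain ⟨δ, hδ, hδU⟩ := Metric.isOpen_iff.1 hU x hx
    refine ⟨δ / 4, by positivity, (closedBall_subset_ball (by linarith)).trans hδU⟩
  -- uniformly Cauchy on `B̄(x, r x)`
  have hCauchy : ∀ x ∈ U, ∃ r > 0, closedBall x (2 * r) ⊆ U ∧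
      UniformCauchySeqOn (fun i => fderiv ℂ (f i)) l (closedBall x r) := by
    intro x hx
    obtain ⟨r, hr, hrU⟩ := hball x hx
    exact ⟨r, hr, hrU, uniformCauchySeqOn_fderiv hU hf hr hrU
      (hK _ hrU (isCompact_closedBall x (2 * r)))⟩
  -- pointwise limits
  have hpt : ∀ x ∈ U, ∃ L : E →L[ℂ] F, Tendsto (fun i => fderiv ℂ (f i) x) l (𝓝 L) := by
    intro x hx
    obtain ⟨r, hr, -, hC⟩ := hCauchy x hx
    exact cauchy_map_iff_exists_tendsto.1 (hC.cauchy_map (mem_closedBall_self hr.le))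
  choose! g' hg' using hpt
  refine ⟨g', ?_⟩
  -- locally uniform convergence to `g'`
  rw [tendstoLocallyUniformlyOn_iff_forall_isCompact hU]
  intro K hKU hKc
  -- cover: it suffices to check on a neighbourhood of each point (uniform convergence on balls)
  refine (tendstoLocallyUniformlyOn_iff_forall_isCompact ?_).1 ?_ K hKU hKc
  · exact hU
  refine fun u hu x hx => ?_
  obtain ⟨r, hr, hrU, hC⟩ := hCauchy x hx
  have hconv : TendstoUniformlyOn (fun i => fderiv ℂ (f i)) g' l (closedBall x r) :=
    hC.tendstoUniformlyOn_of_tendsto fun y hy =>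
      hg' y (hrU (closedBall_subset_closedBall (by linarith) hy))
  refine ⟨closedBall x r, ?_, hconv u hu⟩
  exact mem_nhdsWithin_of_mem_nhds (closedBall_mem_nhds x hr)

/-- **Weierstrass' theorem in several complex variables, derivative form**: under the hypotheses of
`exists_tendstoLocallyUniformlyOn_fderiv`, the limit `g` has a Fréchet derivative at every point of
`U`, equal to the (locally uniform) limit of the derivatives. [cite: HormanderSCV1973, §2.2 (Cor. 2.2.5, several-variable Weierstrass theorem)] -/
theorem hasFDerivAt_of_tendstoLocallyUniformlyOn_of_differentiableOn [FiniteDimensional ℂ E] [l.NeBot]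
    {f : ι → E → F} {g : E → F} {U : Set E} (hU : IsOpen U) (hf : ∀ i, DifferentiableOn ℂ (f i) U)
    (hlim : TendstoLocallyUniformlyOn f g l U) :
    ∃ g' : E → E →L[ℂ] F, TendstoLocallyUniformlyOn (fun i => fderiv ℂ (f i)) g' l U ∧
      ∀ x ∈ U, HasFDerivAt g (g' x) x := by
  obtain ⟨g', hg'⟩ := exists_tendstoLocallyUniformlyOn_fderiv hU hf hlim
  refine ⟨g', hg', fun x hx => ?_⟩
  exact hasFDerivAt_of_tendsto_locally_uniformly_on' hU hg' hf (fun y hy => hlim.tendsto_at hy) hx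

/-- **Weierstrass' theorem in several complex variables**: a locally uniform limit, along a
non-trivial filter, of complex-differentiable maps on an open subset `U` of a finite-dimensional
complex normed space (values in a complete space) is complex-differentiable on `U`. [cite: HormanderSCV1973, §2.2 (Cor. 2.2.5, several-variable Weierstrass theorem)] -/
theorem differentiableOn_of_tendstoLocallyUniformlyOn [FiniteDimensional ℂ E] [l.NeBot]
    {f : ι → E → F} {g : E → F} {U : Set E} (hU : IsOpen U) (hf : ∀ i, DifferentiableOn ℂ (f i) U)
    (hlim : TendstoLocallyUniformlyOn f g l U) : DifferentiableOn ℂ g U := by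
  obtain ⟨g', -, hg'⟩ := hasFDerivAt_of_tendstoLocallyUniformlyOn_of_differentiableOn hU hf hlim
  exact fun x hx => (hg' x hx).differentiableAt.differentiableWithinAt

/-- **Locally uniform limits of holomorphic maps are analytic** (Weierstrass + Osgood). This is
the form in which analyticity passes to thermodynamic limits of free energies ("Vitali theorem"
in Kotecký–Preiss 1986, p. 493, and Ueltschi 1999, proof of Thm. 2.1 (i)). [cite: HormanderSCV1973, §2.2 (Thm 2.2.1, Cor. 2.2.5)] -/
theorem analyticOnNhd_of_tendstoLocallyUniformlyOn [FiniteDimensional ℂ E] [l.NeBot]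
    {f : ι → E → F} {g : E → F} {U : Set E} (hU : IsOpen U) (hf : ∀ i, DifferentiableOn ℂ (f i) U)
    (hlim : TendstoLocallyUniformlyOn f g l U) : AnalyticOnNhd ℂ g U :=
  analyticOnNhd_of_differentiableOn (differentiableOn_of_tendstoLocallyUniformlyOn hU hf hlim) hU

/-- Eventual version: it suffices that the maps are complex-differentiable for `i` in a set of the
filter. [cite: HormanderSCV1973, §2.2 (Thm 2.2.1, Cor. 2.2.5)] -/
theorem analyticOnNhd_of_tendstoLocallyUniformlyOn_of_eventually [FiniteDimensional ℂ E] [l.NeBot]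
    {f : ι → E → F} {g : E → F} {U : Set E} (hU : IsOpen U)
    (hf : ∀ᶠ i in l, DifferentiableOn ℂ (f i) U) (hlim : TendstoLocallyUniformlyOn f g l U) :
    AnalyticOnNhd ℂ g U := by
  -- restrict the filter to the set where differentiability holds
  set S : Set ι := {i | DifferentiableOn ℂ (f i) U}
  have hlim' : TendstoLocallyUniformlyOn (fun i : S => f i) g (Filter.comap Subtype.val l) U := by
    intro u hu x hx
    obtain ⟨t, ht, hev⟩ := hlim u hu x hx
    exact ⟨t, ht, hev.comap Subtype.val⟩
  haveI : (Filter.comap (Subtype.val : S → ι) l).NeBot := by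
    refine Filter.comap_neBot fun V hV => ?_
    obtain ⟨i, hiV, hiS⟩ := Filter.nonempty_of_mem (Filter.inter_mem hV hf)
    exact ⟨⟨i, hiS⟩, hiV⟩
  exact analyticOnNhd_of_tendstoLocallyUniformlyOn hU (fun i : S => i.2) hlim'

/-- **Normally convergent series of holomorphic maps are analytic** (Weierstrass `M`-test form):
if `f_i` are complex-differentiable on an open `U` (finite-dimensional domain, complete codomain)
and `‖f_i(x)‖ ≤ u_i` on `U` with `Σ u_i < ∞`, then `x ↦ Σ' f_i(x)` is analytic on `U`. This is the
shape in which cluster expansions (sums over clusters of analytic weights with summable uniform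
bounds) are shown to be analytic. [cite: KoteckyPreiss1986, p. 493 (analyticity of Φ^T sums via Vitali)] -/
theorem analyticOnNhd_tsum_of_summable_norm [FiniteDimensional ℂ E] {f : ι → E → F} {U : Set E}
    (hU : IsOpen U) (hf : ∀ i, DifferentiableOn ℂ (f i) U) {u : ι → ℝ} (hu : Summable u)
    (hfu : ∀ i, ∀ x ∈ U, ‖f i x‖ ≤ u i) :
    AnalyticOnNhd ℂ (fun x => ∑' i, f i x) U := by
  classical
  have hlim : TendstoLocallyUniformlyOn (fun s : Finset ι => fun x => ∑ i ∈ s, f i x)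
      (fun x => ∑' i, f i x) atTop U :=
    (tendstoUniformlyOn_tsum hu hfu).tendstoLocallyUniformlyOn
  refine analyticOnNhd_of_tendstoLocallyUniformlyOn hU (fun s => ?_) hlim
  exact DifferentiableOn.fun_sum fun i _ => hf i

end Literature.Analysis.Complex.SCV
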